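import Summits.BirchSwinnertonDyer.BirchSwinnertonDyer.Theorems.TwoAdicConverseBDPSelmerLowerDivisibilityAtTwoEisensteinDevissage
import Summits.BirchSwinnertonDyer.BirchSwinnertonDyer.Theorems.TwoAdicConverseBDPTrivialCharSplitLineFiniteOfPrintFacts
import Summits.BirchSwinnertonDyer.BirchSwinnertonDyer.Theorems.TwoAdicConverseBDPSplitPrimeLineFinitelyDecomposedHolds
import HarnessLib

/-!
# Crux O2 `BDPSelmerLowerDivisibilityAtTwo` (stmt-BirchSwinnertonDyer-24728), line of record v7: pieces P4 ∧ P5 ⟹ P1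
# (`SplitPrimeLineSelmerFiniteAt`) on habitat (β) MODULO TWO PRINT FACTS {Greenberg 1978 §4, Oukhaba–Viguié 2016 Thm 1.2}

Cell `bsd-2adic`, seat `bsd-2adic-conv-1` GEN 40 (`--supports stmt-BirchSwinnertonDyer-24728`, helper; by-name convenience for the
lead's v8 re-cut, pen RC-612 (1)). THEOREMS ONLY: no definition, no named fact, no instance, no `sorry`; the two print facts stay
DISPLAYED hypotheses (named Literature `def … : Prop`s, typed by t42 GEN 36); O2 / 19556 / 19218 stay OPEN; BSD is proved for no curve.

* `trivialCharSplitLineFiniteAtTwo_of_twoPrintFacts (hGr) (hOV) (K)` — t42's P4 bridge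
  `TwoAdicBDPTrivialCharLine.trivialCharSplitLineFiniteAtTwo_of_printFacts hGr hOV hdec` (p774822) with its third binder `hdec`
  DISCHARGED by `TwoAdicBDPSplitLineDecomposition.deShalit1987_propII19iii_holds` (HDEC-DISCHARGE): seat 2's
  `TrivialCharSplitLineFiniteAt K` (unfolded) under {Gr78 §4, OV16 1.2} only;
* `lineSelmerTwoTorsionFinite_of_twoPrintFacts (W) (K) (hred) (hGr) (hOV)` — seat 2's P1 `SplitPrimeLineSelmerFiniteAt W K`
  (unfolded: FIN-LINE of `E_K[2^∞]` over every `ℤ₂`-line of the imaginary quadratic `K` ramified only at the relaxed prime `v`) on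
  habitat (β) (`E[2]` reducible over `ℚ`) under the same two print facts: P5 (`eisensteinDevissageAt_two`, p775208) ∘ P4.

So, by name: v7's `torsionResidue_of_splitPieces` needs only P3 (`stub_torsionResidueTransport`, tower-1 GEN 49) beyond
{thmII417-free} print {Gr78 §4, OV16 1.2} to deliver TORSION ∧ RESIDUE at every adapted pair.

References: [Greenberg1978] §4; [OukhabaViguie2016MuInvariant] Thm 1.2; [deShalit1987] II.1.9 (iii); node card
`Cruxes/BDPSelmerLowerDivisibilityAtTwo/Lines/split_prime_line_finite_two.md`.
-/

set_option autoImplicit false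
-- D-0017: the summit and its sub-problem share the name `BirchSwinnertonDyer`.
set_option linter.dupNamespace false

noncomputable section

open scoped Classical

namespace Summit.BirchSwinnertonDyer.BirchSwinnertonDyer.Theorems.TwoAdicBDPEisensteinDevissage

open NumberField IsDedekindDomain Field WeierstrassCurve
open Literature.NumberTheory.GaloisRepresentations Literature.NumberTheory.EllipticCurves
  Literature.NumberTheory.EllipticCurves.GreenbergSelmer Literature.NumberTheory.EllipticCurves.GreenbergVatsal2000
  Literature.NumberTheory.IwasawaTheory

/-- **P4 under TWO print facts** — t42's bridge with `hdec` discharged (`deShalit1987_propII19iii_holds`): for every number field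
`K` (guarded inside by `IsImaginaryQuadratic K`), the `2`-torsion of the trivial-character datum Selmer group over every `ℤ₂`-line
ramified only at `v` is finite, at every finite `S₀`, GIVEN Greenberg 1978 §4 (`X_∞` f.g. torsion) and Oukhaba–Viguié 2016 Thm 1.2
(`μ = 0`). [cite: Greenberg1978, §4 (closing Remark)] [cite: OukhabaViguie2016MuInvariant, Thm 1.2] [cite: deShalit1987, II.1.9 (iii)] -/
theorem trivialCharSplitLineFiniteAtTwo_of_twoPrintFacts
    (hGr : Greenberg1978.splitPrime_iwasawaModule_finite_torsion)
    (hOV : OukhabaViguie2016.thm12_splitPrime_muInvariant_eq_zero)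
    (K : Type) [Field K] [NumberField K] :
    IsImaginaryQuadratic K → ∀ (v vbar : HeightOneSpectrum (𝓞 K)) (κ : ZpExtension K 2)
      (S₀ : Set (HeightOneSpectrum (𝓞 K))), S₀.Finite →
      ((2 : ℕ) : 𝓞 K) ∈ v.asIdeal → ((2 : ℕ) : 𝓞 K) ∈ vbar.asIdeal → vbar ≠ v →
      Literature.NumberTheory.FaltingsSerre.inertiaOutside K {v} ⊆
        ((κ.kerSubgroup : Subgroup (Field.absoluteGaloisGroup K)) : Set (Field.absoluteGaloisGroup K)) →
      Set.Finite {t : Literature.NumberTheory.EllipticCurves.subgroupH1 κ.kerSubgroup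
          (KellerYin2024.charModule (∅ : Set (PadicAlgCl 2))
            (1 : FramedGaloisRep K (padicCoeffIntegers (∅ : Set (PadicAlgCl 2))) 1)) |
        t ∈ datumSelmerInfty κ
            (KellerYin2024.charModule (∅ : Set (PadicAlgCl 2))
              (1 : FramedGaloisRep K (padicCoeffIntegers (∅ : Set (PadicAlgCl 2))) 1))
            (Castella2018.AcSelmer.bdpData
              (KellerYin2024.charModule (∅ : Set (PadicAlgCl 2))
                (1 : FramedGaloisRep K (padicCoeffIntegers (∅ : Set (PadicAlgCl 2))) 1)) 2 vbar) S₀ ∧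
          2 • t = 0} :=
  TwoAdicBDPTrivialCharLine.trivialCharSplitLineFiniteAtTwo_of_printFacts hGr hOV
    TwoAdicBDPSplitLineDecomposition.deShalit1987_propII19iii_holds K

/-- **P1 `SplitPrimeLineSelmerFiniteAt W K` on habitat (β) under TWO print facts** (seat 2's decl, unfolded): for `W/ℚ` with
`E[2]` reducible and any number field `K` — if `K` is imaginary quadratic with `2 = v v̄` split, then over EVERY `ℤ₂`-extension `κ₂`
of `K` ramified only at `v` the `2`-torsion of Greenberg's BDP-type Selmer group of `E_K[2^∞]` (`datumSelmerInfty κ₂ E_K[2^∞]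
(bdpData _ 2 v̄) ∅`: relaxed above `v`, unramified above `v̄` and everywhere else) is finite, GIVEN Gr78 §4 and OV16 Thm 1.2.
P5 (`eisensteinDevissageAt_two`) applied to P4 (`trivialCharSplitLineFiniteAtTwo_of_twoPrintFacts`).
[cite: Greenberg1978, §4] [cite: OukhabaViguie2016MuInvariant, Thm 1.2] [cite: CastellaGrossiLeeSkinner2022, §1.4 Props. 17–18] -/
theorem lineSelmerTwoTorsionFinite_of_twoPrintFacts (W : WeierstrassCurve ℚ) [W.IsElliptic]
    (K : Type) [Field K] [NumberField K] (hred : ¬ W.HasIrreducibleModPGaloisRep 2)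
    (hGr : Greenberg1978.splitPrime_iwasawaModule_finite_torsion)
    (hOV : OukhabaViguie2016.thm12_splitPrime_muInvariant_eq_zero)
    (hK : IsImaginaryQuadratic K) (v vbar : HeightOneSpectrum (𝓞 K)) (κ₂ : ZpExtension K 2)
    (hv : ((2 : ℕ) : 𝓞 K) ∈ v.asIdeal) (hvbar : ((2 : ℕ) : 𝓞 K) ∈ vbar.asIdeal) (hne : vbar ≠ v)
    (hram : Literature.NumberTheory.FaltingsSerre.inertiaOutside K {v} ⊆
      ((κ₂.kerSubgroup : Subgroup (Field.absoluteGaloisGroup K)) : Set (Field.absoluteGaloisGroup K))) :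
    Set.Finite {t : (W.baseChange K).subgroupH1 2 κ₂.kerSubgroup |
      t ∈ datumSelmerInfty κ₂ ((W.baseChange K).geomPrimaryTorsion 2)
        (Castella2018.AcSelmer.bdpData ((W.baseChange K).geomPrimaryTorsion 2) 2 vbar) ∅ ∧ 2 • t = 0} :=
  eisensteinDevissageAt_two W K hred (trivialCharSplitLineFiniteAtTwo_of_twoPrintFacts hGr hOV K) hK v vbar κ₂ hv hvbar hne
    hram

end Summit.BirchSwinnertonDyer.BirchSwinnertonDyer.Theorems.TwoAdicBDPEisensteinDevissage

end
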